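import Literature.Analysis.SpecialFunctions.ZhouTripleEllipticIntegral
import Literature.Analysis.SpecialFunctions.LemniscaticEllipticValuesProofs
import Literature.Probability.RandomPlanarGeometry.EllipticKBasic
import HarnessLib

/-!
# Zhou 2013, Proposition 5.1 — proofs, part I: real analysis of `completeEllipticK`, Landen

Companion ("`…Proofs`") file of `ZhouTripleEllipticIntegral.lean` (named fact `Zhou2013_prop_5_1`:
`∫₀¹ K(√(1−k²))³ dk = Γ(¼)⁸/(128π²)`, Y. Zhou, Ramanujan J. 34 (2014) 373–428 = arXiv:1301.1735,
Prop. 5.1). The printed proof has three layers: (a) a Tricomi-transform pairing giving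
`∫₀¹K′³ = 3∫₀¹K²K′`; (b) Landen's transformation giving `3∫₀¹K²K′ = 6∫₀¹K²K′k`; (c) the
Clebsch–Gordan value `6∫₀¹K²K′k dk = Γ(¼)⁸/(128π²)` (Cor. 3.2, eq. (T_half_half), from Prop. 3.1).
This file lays the real-variable groundwork all three layers rest on, for the tree's
`completeEllipticK k = ∫_{(0,1)} dt/√((1−t²)(1−k²t²))`:

* the bridge `completeEllipticK k = ellipticK (k²)` to the parameter-form API of
  `Literature/Probability/RandomPlanarGeometry/EllipticKBasic.lean` (positivity, monotonicity,
  continuity, `K(0) = π/2`);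
* the power majorant `K(u) ≤ (2/θ)(1−u)^{−θ/2}` (`0 ≤ u < 1`, `0 < θ ≤ 1`), whence
  `K(√(1−k²)) ≤ 8k^{−1/4}`, `K(k) ≤ 8(1−k²)^{−1/8}` on `(0,1)`;
* measurability/continuity of `k ↦ K(k)`, `k ↦ K(√(1−k²))` on `(0,1)` and the integrability on
  `(0,1)` of the cubic products `K′³`, `K²K′`, `KK′²`, `K²K′k` appearing in Prop. 5.1 (so every
  integral in the printed chain is a genuine Bochner integral);
* **Landen's transformation** `K(k) = (2/(1+k′))K((1−k′)/(1+k′))` (`0 < k < 1`, `k′ = √(1−k²)`),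
  proved through the arithmetic–geometric-mean integral `I(a,b) = ∫_{(0,∞)} dx/√((x²+a²)(x²+b²))`:
  `I(a,b) = K(1−b²/a²)/a` (substitution `x = bt/√(1−t²)`) and Gauss's invariance
  `I((a+b)/2, √(ab)) = I(a,b)` (substitution `x = (t − ab/t)/2`), with the ascending/descending
  forms `K(2√ξ/(1+ξ)) = (1+ξ)K(ξ)`, `K((1−ξ)/(1+ξ)) = ((1+ξ)/2)K(√(1−ξ²))` used by Zhou;
* layer (b) of the printed proof, **the second line of Prop. 5.1**:
  `∫₀¹K²K′ dk = 2∫₀¹K²K′k dk` and `∫₀¹KK′² dk = 3∫₀¹K²K′k dk` (i.e. `3∫K²K′ = 2∫KK′² = 6∫K²K′k`),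
  by the substitution `k = (1−ξ)/(1+ξ)` and Landen twice, exactly as printed;
* **the first line of Prop. 5.1**, `∫₀¹K′³ dk = (10/3)∫₀¹K³ dk = 5∫₀¹K³k dk (= 5∫₀¹K′³k dk)`, by
  the same substitution and Landen ("The two simultaneous equations displayed above make it
  possible to eliminate any one among the three quantities…"), exactly as printed.

Layer (a) (`∫₀¹K′³ = 3∫₀¹K²K′`, in print by Tricomi pairing) is proved in the sequel
`ZhouTripleEllipticIntegralWick.lean` (by a Wick rotation); layer (c) (the value
`6∫₀¹K²K′k dk = Γ(¼)⁸/(128π²)`, Zhou's Cor. 3.2 eq. (T_half_half)) is not in the tree.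

## References

* [Zhou2013] Y. Zhou, Ramanujan J. 34 (2014) 373–428, Prop. 5.1 (arXiv:1301.1735 p. 23).
* J. M. Borwein, P. B. Borwein, *Pi and the AGM* (1987), §1.2 (Gauss's AGM substitution).
-/

noncomputable section

open Real _root_.MeasureTheory _root_.Set _root_.Filter
open scoped _root_.Topology

namespace Literature.Analysis.SpecialFunctions

open Literature.Probability.RandomPlanarGeometry

/-! ### The bridge to the parameter form `ellipticK` -/

/-- `K(k)` (modulus form, Bochner integral over `(0,1)`) is the parameter-form
`ellipticK (k²) = ∫₀¹ dt/√((1−t²)(1−k²t²))` of `RectangleModulus.lean`. [folklore] -/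
theorem completeEllipticK_eq_ellipticK (k : ℝ) : completeEllipticK k = ellipticK (k ^ 2) := by
  rw [completeEllipticK, Literature.Probability.RandomPlanarGeometry.ellipticK,
    intervalIntegral.integral_of_le zero_le_one, integral_Ioc_eq_integral_Ioo]

/-- The complementary integral: for `k² ≤ 1`, `K(√(1−k²)) = ellipticK (1 − k²)`. [folklore] -/
theorem completeEllipticK_compl_eq_ellipticK {k : ℝ} (hk : k ^ 2 ≤ 1) :
    completeEllipticK (Real.sqrt (1 - k ^ 2)) = ellipticK (1 - k ^ 2) := by
  rw [completeEllipticK_eq_ellipticK, Real.sq_sqrt (by linarith)]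

/-- `K(0) = π/2`. [folklore] -/
theorem completeEllipticK_zero : completeEllipticK 0 = π / 2 := by
  rw [completeEllipticK_eq_ellipticK]
  simpa using ellipticK_zero

/-- `K(k) ≥ 0` for every real `k`. [folklore] -/
theorem completeEllipticK_nonneg (k : ℝ) : 0 ≤ completeEllipticK k := by
  rw [completeEllipticK_eq_ellipticK]; exact ellipticK_nonneg _

/-- `π/2 ≤ K(k)` for `k² < 1`. [folklore] -/
theorem pi_div_two_le_completeEllipticK {k : ℝ} (hk : k ^ 2 < 1) : π / 2 ≤ completeEllipticK k := by
  rw [completeEllipticK_eq_ellipticK]; exact pi_div_two_le_ellipticK (sq_nonneg k) hk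

/-- `0 < K(k)` for `k² < 1`. [folklore] -/
theorem completeEllipticK_pos {k : ℝ} (hk : k ^ 2 < 1) : 0 < completeEllipticK k :=
  lt_of_lt_of_le (by positivity) (pi_div_two_le_completeEllipticK hk)

/-- `K` is continuous at every `k` with `k² < 1`. [folklore] -/
theorem continuousAt_completeEllipticK {k : ℝ} (hk : k ^ 2 < 1) : ContinuousAt completeEllipticK k := by
  have h : completeEllipticK = fun k => ellipticK (k ^ 2) := funext completeEllipticK_eq_ellipticK
  rw [h]
  have e : ContinuousAt (fun k : ℝ => ellipticK (k ^ 2)) k :=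
    ContinuousAt.comp (g := ellipticK) (f := fun k : ℝ => k ^ 2)
      (continuousAt_ellipticK hk) (by fun_prop : Continuous fun k : ℝ => k ^ 2).continuousAt
  exact e

/-- `k ↦ K(k)` is continuous on `(0,1)`. [folklore] -/
theorem continuousOn_completeEllipticK_Ioo : ContinuousOn completeEllipticK (Ioo 0 1) :=
  fun k hk => (continuousAt_completeEllipticK (by nlinarith [hk.1, hk.2])).continuousWithinAt

/-- `k ↦ K(√(1−k²))` is continuous on `(0,1)`. [folklore] -/
theorem continuousOn_completeEllipticK_compl_Ioo :
    ContinuousOn (fun k : ℝ => completeEllipticK (Real.sqrt (1 - k ^ 2))) (Ioo 0 1) := by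
  intro k hk
  have hk2 : 1 - k ^ 2 < 1 := by nlinarith [hk.1, hk.2]
  have h : (fun k : ℝ => completeEllipticK (Real.sqrt (1 - k ^ 2))) =ᶠ[𝓝 k]
      fun k => ellipticK (1 - k ^ 2) := by
    have hmem : ∀ᶠ x in 𝓝 k, x ∈ Ioo (0 : ℝ) 1 := Ioo_mem_nhds hk.1 hk.2
    refine hmem.mono fun x hx => ?_
    exact completeEllipticK_compl_eq_ellipticK (by nlinarith [hx.1, hx.2])
  refine ContinuousAt.continuousWithinAt ?_
  refine (ContinuousAt.congr ?_ h.symm)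
  exact ContinuousAt.comp (g := ellipticK) (f := fun k : ℝ => 1 - k ^ 2)
    (continuousAt_ellipticK hk2) (by fun_prop : Continuous fun k : ℝ => 1 - k ^ 2).continuousAt

/-- `k ↦ K(k)` is a.e.-strongly measurable on `(0,1)`. [folklore] -/
theorem aestronglyMeasurable_completeEllipticK_Ioo :
    AEStronglyMeasurable completeEllipticK (volume.restrict (Ioo (0 : ℝ) 1)) :=
  continuousOn_completeEllipticK_Ioo.aestronglyMeasurable measurableSet_Ioo

/-- `k ↦ K(√(1−k²))` is a.e.-strongly measurable on `(0,1)`. [folklore] -/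
theorem aestronglyMeasurable_completeEllipticK_compl_Ioo :
    AEStronglyMeasurable (fun k : ℝ => completeEllipticK (Real.sqrt (1 - k ^ 2)))
      (volume.restrict (Ioo (0 : ℝ) 1)) :=
  continuousOn_completeEllipticK_compl_Ioo.aestronglyMeasurable measurableSet_Ioo

/-! ### A power majorant for `K(u)` as `u → 1⁻` -/

/-- Radicand lower bound: for `0 ≤ u < 1`, `0 ≤ t < 1`, `0 ≤ θ ≤ 1`,
`(1−t)^{2−θ}(1−u)^θ ≤ (1−t²)(1−u t²)` (since `1 − u t² ≥ 1 − ut ≥ max(1−t, 1−u)`). [folklore] -/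
theorem rpow_mul_rpow_le_radicand {u t θ : ℝ} (hu0 : 0 ≤ u) (hu : u < 1) (ht0 : 0 ≤ t) (ht : t < 1)
    (hθ0 : 0 ≤ θ) (hθ1 : θ ≤ 1) :
    (1 - t) ^ (2 - θ) * (1 - u) ^ θ ≤ (1 - t ^ 2) * (1 - u * t ^ 2) := by
  have h1t : 0 < 1 - t := by linarith
  have h1u : 0 < 1 - u := by linarith
  set M := max (1 - t) (1 - u) with hM
  have hM0 : 0 < M := lt_max_of_lt_left h1t
  have hgeom : (1 - t) ^ (1 - θ) * (1 - u) ^ θ ≤ M := by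
    calc (1 - t) ^ (1 - θ) * (1 - u) ^ θ ≤ M ^ (1 - θ) * M ^ θ := by
          apply mul_le_mul (Real.rpow_le_rpow h1t.le (le_max_left _ _) (by linarith))
            (Real.rpow_le_rpow h1u.le (le_max_right _ _) hθ0) (by positivity) (by positivity)
      _ = M := by rw [← Real.rpow_add hM0]; norm_num
  have hM1 : M ≤ 1 - u * t ^ 2 := by
    apply max_le
    · nlinarith [mul_nonneg hu0 ht0]
    · nlinarith [mul_nonneg hu0 ht0]
  have hsplit : (1 - t) ^ (2 - θ) = (1 - t) * (1 - t) ^ (1 - θ) := by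
    rw [show (2 - θ) = 1 + (1 - θ) by ring, Real.rpow_add h1t, Real.rpow_one]
  rw [hsplit, mul_assoc]
  calc (1 - t) * ((1 - t) ^ (1 - θ) * (1 - u) ^ θ) ≤ (1 - t) * (1 - u * t ^ 2) :=
        mul_le_mul_of_nonneg_left (hgeom.trans hM1) h1t.le
    _ ≤ (1 - t ^ 2) * (1 - u * t ^ 2) := by
        apply mul_le_mul_of_nonneg_right _ (by linarith [hM0])
        nlinarith

/-- The power majorant of the integrand: for `0 ≤ u < 1`, `0 ≤ t < 1`, `0 ≤ θ ≤ 1`,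
`1/√((1−t²)(1−u t²)) ≤ (1−u)^{−θ/2} · (1−t)^{−(1−θ/2)}`. [folklore] -/
theorem ellIntegrand_le_rpow {u t θ : ℝ} (hu0 : 0 ≤ u) (hu : u < 1) (ht0 : 0 ≤ t) (ht : t < 1)
    (hθ0 : 0 ≤ θ) (hθ1 : θ ≤ 1) :
    ellIntegrand u t ≤ (1 - u) ^ (-(θ / 2)) * (1 - t) ^ (-(1 - θ / 2)) := by
  have h1t : 0 < 1 - t := by linarith
  have h1u : 0 < 1 - u := by linarith
  have hA : 0 < (1 - t) ^ (2 - θ) := Real.rpow_pos_of_pos h1t _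
  have hB : 0 < (1 - u) ^ θ := Real.rpow_pos_of_pos h1u _
  have hR : 0 < (1 - t) ^ (2 - θ) * (1 - u) ^ θ := mul_pos hA hB
  have hle := rpow_mul_rpow_le_radicand hu0 hu ht0 ht hθ0 hθ1
  unfold ellIntegrand
  calc 1 / Real.sqrt ((1 - t ^ 2) * (1 - u * t ^ 2))
        ≤ 1 / Real.sqrt ((1 - t) ^ (2 - θ) * (1 - u) ^ θ) :=
          one_div_le_one_div_of_le (Real.sqrt_pos.mpr hR) (Real.sqrt_le_sqrt hle)
    _ = (1 - u) ^ (-(θ / 2)) * (1 - t) ^ (-(1 - θ / 2)) := by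
          rw [Real.sqrt_eq_rpow, one_div, ← Real.rpow_neg hR.le, Real.mul_rpow hA.le hB.le,
            ← Real.rpow_mul h1t.le, ← Real.rpow_mul h1u.le, mul_comm]
          congr 1 <;> (congr 1; ring)

/-- `∫₀¹ (1−t)^{−(1−θ/2)} dt = 2/θ` for `0 < θ`. [folklore] -/
theorem integral_one_sub_rpow_neg {θ : ℝ} (hθ : 0 < θ) :
    ∫ t in (0:ℝ)..1, (1 - t) ^ (-(1 - θ / 2)) = 2 / θ := by
  have key := intervalIntegral.integral_comp_sub_left (a := 0) (b := 1)
    (fun x : ℝ => x ^ (-(1 - θ / 2))) 1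
  simp only [sub_self, sub_zero] at key
  rw [key, integral_rpow (Or.inl (by linarith))]
  have hne : -(1 - θ / 2) + 1 ≠ 0 := by
    intro h; have : θ = 0 := by linarith
    exact hθ.ne' this
  rw [Real.one_rpow, Real.zero_rpow hne, show -(1 - θ / 2) + 1 = θ / 2 by ring, sub_zero,
    div_div_eq_mul_div, one_mul]

/-- The bound `(1−u)^{−θ/2}(1−t)^{−(1−θ/2)}` is integrable on `[0,1]` for `θ > 0`. [folklore] -/
theorem intervalIntegrable_rpow_bound {u θ : ℝ} (hθ : 0 < θ) :
    IntervalIntegrable (fun t : ℝ => (1 - u) ^ (-(θ / 2)) * (1 - t) ^ (-(1 - θ / 2))) volume 0 1 := by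
  have h := (intervalIntegral.intervalIntegrable_rpow' (a := 1) (b := 0)
    (show (-1 : ℝ) < -(1 - θ / 2) by linarith)).comp_sub_left 1
  simp only [sub_self, sub_zero] at h
  exact h.const_mul _

/-- **Power majorant for `K`**: for `0 ≤ u < 1` and `0 < θ ≤ 1`, `K(u) ≤ (2/θ)·(1−u)^{−θ/2}`.
[folklore] -/
theorem ellipticK_le_rpow {u θ : ℝ} (hu0 : 0 ≤ u) (hu : u < 1) (hθ : 0 < θ) (hθ1 : θ ≤ 1) :
    ellipticK u ≤ 2 / θ * (1 - u) ^ (-(θ / 2)) := by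
  rw [ellipticK_eq]
  calc ∫ t in (0:ℝ)..1, ellIntegrand u t
        ≤ ∫ t in (0:ℝ)..1, (1 - u) ^ (-(θ / 2)) * (1 - t) ^ (-(1 - θ / 2)) := by
          refine intervalIntegral.integral_mono_on zero_le_one
            (intervalIntegrable_ellIntegrand_of_lt_one hu) (intervalIntegrable_rpow_bound hθ)
            fun t ht => ?_
          rcases lt_or_eq_of_le ht.2 with h1 | h1
          · exact ellIntegrand_le_rpow hu0 hu ht.1 h1 hθ.le hθ1
          · subst h1
            have hne : -(1 - θ / 2) ≠ 0 := by
              intro h; have : θ = 2 := by linarith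
              linarith
            rw [sub_self, Real.zero_rpow hne, mul_zero]
            simp [ellIntegrand]
    _ = 2 / θ * (1 - u) ^ (-(θ / 2)) := by
          rw [intervalIntegral.integral_const_mul, integral_one_sub_rpow_neg hθ, mul_comm]

/-- On `(0,1)`: `K(√(1−k²)) ≤ 8·k^{−1/4}` (`θ = ¼` in `ellipticK_le_rpow`). [folklore] -/
theorem completeEllipticK_compl_le {k : ℝ} (hk : k ∈ Ioo (0 : ℝ) 1) :
    completeEllipticK (Real.sqrt (1 - k ^ 2)) ≤ 8 * k ^ (-(1 / 4 : ℝ)) := by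
  have hk2 : k ^ 2 ≤ 1 := by nlinarith [hk.1, hk.2]
  rw [completeEllipticK_compl_eq_ellipticK hk2]
  have h := ellipticK_le_rpow (u := 1 - k ^ 2) (θ := 1 / 4) (by nlinarith [hk.1, hk.2])
    (by nlinarith [hk.1, hk.2]) (by norm_num) (by norm_num)
  have hk4 : (1 - (1 - k ^ 2)) ^ (-((1 / 4 : ℝ) / 2)) = k ^ (-(1 / 4 : ℝ)) := by
    rw [sub_sub_cancel, show k ^ 2 = k ^ (2 : ℝ) by norm_cast, ← Real.rpow_mul hk.1.le]
    norm_num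
  rw [hk4] at h
  linarith

/-- On `(0,1)`: `K(k) ≤ 8·(1−k²)^{−1/8}` (`θ = ¼` in `ellipticK_le_rpow`). [folklore] -/
theorem completeEllipticK_le {k : ℝ} (hk : k ∈ Ioo (0 : ℝ) 1) :
    completeEllipticK k ≤ 8 * (1 - k ^ 2) ^ (-(1 / 8 : ℝ)) := by
  rw [completeEllipticK_eq_ellipticK]
  have h := ellipticK_le_rpow (u := k ^ 2) (θ := 1 / 4) (sq_nonneg k)
    (by nlinarith [hk.1, hk.2]) (by norm_num) (by norm_num)
  norm_num at h ⊢
  exact h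

/-! ### Integrability of the cubic products on `(0,1)` -/

/-- `k ↦ k^{-r}` is integrable on `(0,1)` for `r < 1`. [folklore] -/
theorem integrableOn_Ioo_rpow_neg {r : ℝ} (hr : r < 1) :
    IntegrableOn (fun k : ℝ => k ^ (-r)) (Ioo 0 1) := by
  have h := intervalIntegral.intervalIntegrable_rpow' (a := 0) (b := 1)
    (show (-1 : ℝ) < -r by linarith)
  rw [intervalIntegrable_iff_integrableOn_Ioo_of_le zero_le_one] at h
  exact h

/-- `k ↦ (1−k²)^{-r}` is integrable on `(0,1)` for `0 ≤ r < 1` (it is `≤ (1−k)^{-r}`). [folklore] -/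
theorem integrableOn_Ioo_one_sub_sq_rpow_neg {r : ℝ} (hr0 : 0 ≤ r) (hr : r < 1) :
    IntegrableOn (fun k : ℝ => (1 - k ^ 2) ^ (-r)) (Ioo 0 1) := by
  have h := (intervalIntegral.intervalIntegrable_rpow' (a := 1) (b := 0)
    (show (-1 : ℝ) < -r by linarith)).comp_sub_left 1
  simp only [sub_self, sub_zero] at h
  rw [intervalIntegrable_iff_integrableOn_Ioo_of_le zero_le_one] at h
  refine h.mono' ?_ ?_
  · exact (ContinuousOn.rpow_const (by fun_prop) fun k hk => Or.inl (by nlinarith [hk.1, hk.2])).aestronglyMeasurable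
      measurableSet_Ioo
  · refine (ae_restrict_mem measurableSet_Ioo).mono fun k hk => ?_
    have h1 : 0 < 1 - k := by linarith [hk.2]
    have h2 : 1 - k ≤ 1 - k ^ 2 := by nlinarith [hk.1, hk.2]
    rw [Real.norm_eq_abs, abs_of_nonneg (Real.rpow_nonneg (by linarith) _)]
    exact Real.rpow_le_rpow_of_nonpos h1 h2 (by linarith)

/-- Generic integrability lemma for the cubic products: a function on `(0,1)`, a.e.-strongly
measurable there and bounded by `C · k^{−a} · (1−k²)^{−b}` with `a, b ∈ [0,1)`, `a + b < 1`… — we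
only need the two extreme cases, so we state them separately. First: bound `C·k^{-a}`. [folklore] -/
theorem integrableOn_Ioo_of_le_rpow_neg {f : ℝ → ℝ} {C a : ℝ} (ha : a < 1)
    (hf : AEStronglyMeasurable f (volume.restrict (Ioo (0 : ℝ) 1)))
    (hle : ∀ k ∈ Ioo (0 : ℝ) 1, |f k| ≤ C * k ^ (-a)) : IntegrableOn f (Ioo 0 1) := by
  refine ((integrableOn_Ioo_rpow_neg ha).const_mul C).mono' hf ?_
  refine (ae_restrict_mem measurableSet_Ioo).mono fun k hk => ?_
  rw [Real.norm_eq_abs]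
  exact hle k hk

/-- Second: bound `C·k^{-a}·(1−k²)^{-b}` with `a, b < 1`, handled by splitting `(0,1)` at `½`:
on `(0,½]` the second factor is bounded, on `[½,1)` the first. [folklore] -/
theorem integrableOn_Ioo_of_le_rpow_neg_mul {f : ℝ → ℝ} {C a b : ℝ} (hC : 0 ≤ C)
    (ha0 : 0 ≤ a) (ha : a < 1) (hb0 : 0 ≤ b) (hb : b < 1)
    (hf : AEStronglyMeasurable f (volume.restrict (Ioo (0 : ℝ) 1)))
    (hle : ∀ k ∈ Ioo (0 : ℝ) 1, |f k| ≤ C * k ^ (-a) * (1 - k ^ 2) ^ (-b)) :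
    IntegrableOn f (Ioo 0 1) := by
  -- the sum of the two one-sided majorants dominates everywhere on (0,1)
  have hmaj : ∀ k ∈ Ioo (0 : ℝ) 1,
      |f k| ≤ C * (2 : ℝ) ^ b * (2 : ℝ) * k ^ (-a) + C * (2 : ℝ) ^ a * (1 - k ^ 2) ^ (-b) := by
    intro k hk
    have hka : 0 < k ^ (-a) := Real.rpow_pos_of_pos hk.1 _
    have h1k2 : 0 < 1 - k ^ 2 := by nlinarith [hk.1, hk.2]
    have hkb : 0 < (1 - k ^ 2) ^ (-b) := Real.rpow_pos_of_pos h1k2 _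
    refine (hle k hk).trans ?_
    rcases le_or_gt k (1 / 2) with hk12 | hk12
    · -- k ≤ 1/2: (1-k²)^{-b} ≤ (3/4)^{-b} ≤ 2^b · 2 (crudely)
      have h34 : (3 / 4 : ℝ) ≤ 1 - k ^ 2 := by nlinarith [hk.1]
      have hb1 : (1 - k ^ 2) ^ (-b) ≤ (3 / 4 : ℝ) ^ (-b) :=
        Real.rpow_le_rpow_of_nonpos (by norm_num) h34 (by linarith)
      have hb2 : (3 / 4 : ℝ) ^ (-b) ≤ (2 : ℝ) ^ b * 2 := by
        rw [show (3 / 4 : ℝ) = (4 / 3)⁻¹ by norm_num, Real.inv_rpow (by norm_num), ← Real.rpow_neg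
          (by norm_num), neg_neg]
        calc (4 / 3 : ℝ) ^ b ≤ (2 : ℝ) ^ b := Real.rpow_le_rpow (by norm_num) (by norm_num) hb0
          _ ≤ (2 : ℝ) ^ b * 2 := by
              have : (1 : ℝ) ≤ (2 : ℝ) ^ b := Real.one_le_rpow (by norm_num) hb0
              nlinarith
      calc C * k ^ (-a) * (1 - k ^ 2) ^ (-b) ≤ C * k ^ (-a) * ((2 : ℝ) ^ b * 2) := by
            apply mul_le_mul_of_nonneg_left (hb1.trans hb2) (by positivity)
        _ = C * (2 : ℝ) ^ b * 2 * k ^ (-a) := by ring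
        _ ≤ C * (2 : ℝ) ^ b * 2 * k ^ (-a) + C * (2 : ℝ) ^ a * (1 - k ^ 2) ^ (-b) := by
            have : 0 ≤ C * (2 : ℝ) ^ a * (1 - k ^ 2) ^ (-b) := by positivity
            linarith
    · -- k > 1/2: k^{-a} ≤ (1/2)^{-a} = 2^a
      have ha1 : k ^ (-a) ≤ (1 / 2 : ℝ) ^ (-a) :=
        Real.rpow_le_rpow_of_nonpos (by norm_num) hk12.le (by linarith)
      have ha2 : (1 / 2 : ℝ) ^ (-a) = (2 : ℝ) ^ a := by
        rw [one_div, Real.inv_rpow (by norm_num), ← Real.rpow_neg (by norm_num), neg_neg]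
      calc C * k ^ (-a) * (1 - k ^ 2) ^ (-b) ≤ C * (2 : ℝ) ^ a * (1 - k ^ 2) ^ (-b) := by
            apply mul_le_mul_of_nonneg_right _ hkb.le
            exact mul_le_mul_of_nonneg_left (ha1.trans ha2.le) hC
        _ ≤ C * (2 : ℝ) ^ b * 2 * k ^ (-a) + C * (2 : ℝ) ^ a * (1 - k ^ 2) ^ (-b) := by
            have : 0 ≤ C * (2 : ℝ) ^ b * 2 * k ^ (-a) := by positivity
            linarith
  have hint : IntegrableOn (fun k : ℝ => C * (2 : ℝ) ^ b * 2 * k ^ (-a) +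
      C * (2 : ℝ) ^ a * (1 - k ^ 2) ^ (-b)) (Ioo 0 1) :=
    ((integrableOn_Ioo_rpow_neg ha).const_mul _).add
      ((integrableOn_Ioo_one_sub_sq_rpow_neg hb0 hb).const_mul _)
  refine hint.mono' hf ?_
  refine (ae_restrict_mem measurableSet_Ioo).mono fun k hk => ?_
  rw [Real.norm_eq_abs]
  exact hmaj k hk

/-- **`K(√(1−k²))³` is integrable on `(0,1)`** (`≤ 512·k^{−3/4}`): the integral of Zhou's Prop. 5.1
is a genuine Bochner integral. [cite: Zhou2013, Prop. 5.1] -/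
theorem integrableOn_completeEllipticK_compl_pow_three :
    IntegrableOn (fun k : ℝ => completeEllipticK (Real.sqrt (1 - k ^ 2)) ^ 3) (Ioo 0 1) := by
  refine integrableOn_Ioo_of_le_rpow_neg (C := 512) (a := 3 / 4) (by norm_num)
    (aestronglyMeasurable_completeEllipticK_compl_Ioo.pow 3) fun k hk => ?_
  have h0 : 0 ≤ completeEllipticK (Real.sqrt (1 - k ^ 2)) := completeEllipticK_nonneg _
  have h1 := completeEllipticK_compl_le hk
  have hk0 : 0 < k ^ (-(1 / 4 : ℝ)) := Real.rpow_pos_of_pos hk.1 _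
  rw [abs_of_nonneg (pow_nonneg h0 3)]
  calc completeEllipticK (Real.sqrt (1 - k ^ 2)) ^ 3 ≤ (8 * k ^ (-(1 / 4 : ℝ))) ^ 3 :=
        pow_le_pow_left₀ h0 h1 3
    _ = 512 * k ^ (-(3 / 4 : ℝ)) := by
        rw [mul_pow, ← Real.rpow_natCast (k ^ (-(1 / 4 : ℝ))), ← Real.rpow_mul hk.1.le]
        norm_num

/-- `K(k)²·K(√(1−k²))` is integrable on `(0,1)` (`≤ 512·k^{−1/4}(1−k²)^{−1/4}`).
[cite: Zhou2013, Prop. 5.1] -/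
theorem integrableOn_completeEllipticK_sq_mul_compl :
    IntegrableOn (fun k : ℝ => completeEllipticK k ^ 2 * completeEllipticK (Real.sqrt (1 - k ^ 2)))
      (Ioo 0 1) := by
  refine integrableOn_Ioo_of_le_rpow_neg_mul (C := 512) (a := 1 / 4) (b := 1 / 4) (by norm_num)
    (by norm_num) (by norm_num) (by norm_num) (by norm_num)
    ((aestronglyMeasurable_completeEllipticK_Ioo.pow 2).mul
      aestronglyMeasurable_completeEllipticK_compl_Ioo) fun k hk => ?_
  have h0 : 0 ≤ completeEllipticK (Real.sqrt (1 - k ^ 2)) := completeEllipticK_nonneg _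
  have h0' : 0 ≤ completeEllipticK k := completeEllipticK_nonneg _
  have h1 := completeEllipticK_compl_le hk
  have h2 := completeEllipticK_le hk
  have hka : 0 < k ^ (-(1 / 4 : ℝ)) := Real.rpow_pos_of_pos hk.1 _
  have h1k2 : 0 < 1 - k ^ 2 := by nlinarith [hk.1, hk.2]
  have hkb : 0 < (1 - k ^ 2) ^ (-(1 / 8 : ℝ)) := Real.rpow_pos_of_pos h1k2 _
  rw [abs_of_nonneg (mul_nonneg (pow_nonneg h0' 2) h0)]
  calc completeEllipticK k ^ 2 * completeEllipticK (Real.sqrt (1 - k ^ 2))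
        ≤ (8 * (1 - k ^ 2) ^ (-(1 / 8 : ℝ))) ^ 2 * (8 * k ^ (-(1 / 4 : ℝ))) :=
          mul_le_mul (pow_le_pow_left₀ h0' h2 2) h1 h0 (by positivity)
    _ = 512 * k ^ (-(1 / 4 : ℝ)) * (1 - k ^ 2) ^ (-(1 / 4 : ℝ)) := by
          rw [mul_pow, ← Real.rpow_natCast ((1 - k ^ 2) ^ (-(1 / 8 : ℝ))), ← Real.rpow_mul h1k2.le]
          norm_num
          ring

/-- `K(k)·K(√(1−k²))²` is integrable on `(0,1)` (`≤ 512·k^{−1/2}(1−k²)^{−1/8}`).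
[cite: Zhou2013, Prop. 5.1] -/
theorem integrableOn_completeEllipticK_mul_compl_sq :
    IntegrableOn (fun k : ℝ => completeEllipticK k * completeEllipticK (Real.sqrt (1 - k ^ 2)) ^ 2)
      (Ioo 0 1) := by
  refine integrableOn_Ioo_of_le_rpow_neg_mul (C := 512) (a := 1 / 2) (b := 1 / 8) (by norm_num)
    (by norm_num) (by norm_num) (by norm_num) (by norm_num)
    (aestronglyMeasurable_completeEllipticK_Ioo.mul
      (aestronglyMeasurable_completeEllipticK_compl_Ioo.pow 2)) fun k hk => ?_
  have h0 : 0 ≤ completeEllipticK (Real.sqrt (1 - k ^ 2)) := completeEllipticK_nonneg _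
  have h0' : 0 ≤ completeEllipticK k := completeEllipticK_nonneg _
  have h1 := completeEllipticK_compl_le hk
  have h2 := completeEllipticK_le hk
  have hka : 0 < k ^ (-(1 / 4 : ℝ)) := Real.rpow_pos_of_pos hk.1 _
  have h1k2 : 0 < 1 - k ^ 2 := by nlinarith [hk.1, hk.2]
  have hkb : 0 < (1 - k ^ 2) ^ (-(1 / 8 : ℝ)) := Real.rpow_pos_of_pos h1k2 _
  rw [abs_of_nonneg (mul_nonneg h0' (pow_nonneg h0 2))]
  calc completeEllipticK k * completeEllipticK (Real.sqrt (1 - k ^ 2)) ^ 2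
        ≤ (8 * (1 - k ^ 2) ^ (-(1 / 8 : ℝ))) * (8 * k ^ (-(1 / 4 : ℝ))) ^ 2 :=
          mul_le_mul h2 (pow_le_pow_left₀ h0 h1 2) (by positivity) (by positivity)
    _ = 512 * k ^ (-(1 / 2 : ℝ)) * (1 - k ^ 2) ^ (-(1 / 8 : ℝ)) := by
          rw [mul_pow, ← Real.rpow_natCast (k ^ (-(1 / 4 : ℝ))), ← Real.rpow_mul hk.1.le]
          norm_num
          ring

/-- `K(k)²·K(√(1−k²))·k` is integrable on `(0,1)`. [cite: Zhou2013, Prop. 5.1] -/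
theorem integrableOn_completeEllipticK_sq_mul_compl_mul_id :
    IntegrableOn (fun k : ℝ => completeEllipticK k ^ 2 * completeEllipticK (Real.sqrt (1 - k ^ 2)) * k)
      (Ioo 0 1) := by
  exact integrableOn_completeEllipticK_sq_mul_compl.mul_continuousOn_of_subset continuousOn_id
    measurableSet_Ioo isCompact_Icc Ioo_subset_Icc_self

/-! ### Landen's transformation via the arithmetic–geometric-mean integral

We write `I(a,b) := ∫_{(0,∞)} dx/√((x²+a²)(x²+b²))` (not introduced as a definition). Two changes
of variables: `x = bt/√(1−t²)` gives `I(a,b) = K(1 − b²/a²)/a` (parameter form), and Gauss's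
`x = (t − ab/t)/2` gives `I((a+b)/2, √(ab)) = I(a,b)`; together they are Landen's transformation. -/

/-- Pointwise identity behind `x = bt/√(1−t²)`: for `a, b > 0`, `0 < t < 1`,
`(b/(1−t²)^{3/2}) / √((x²+a²)(x²+b²)) = (1/a)/√((1−t²)(1−(1−b²/a²)t²))` at `x = bt/√(1−t²)`.
[folklore] -/
theorem agm_subst_tan {a b t : ℝ} (ha : 0 < a) (hb : 0 < b) (ht : t ∈ Ioo (0 : ℝ) 1) :
    b / (Real.sqrt (1 - t ^ 2)) ^ 3 *
        (1 / Real.sqrt (((b * t / Real.sqrt (1 - t ^ 2)) ^ 2 + a ^ 2) *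
          ((b * t / Real.sqrt (1 - t ^ 2)) ^ 2 + b ^ 2))) =
      1 / a * (1 / Real.sqrt ((1 - t ^ 2) * (1 - (1 - b ^ 2 / a ^ 2) * t ^ 2))) := by
  obtain ⟨ht0, ht1⟩ := ht
  have hs2 : 0 < 1 - t ^ 2 := by nlinarith
  set s := Real.sqrt (1 - t ^ 2) with hs
  have hs0 : 0 < s := Real.sqrt_pos.mpr hs2
  have hss : s ^ 2 = 1 - t ^ 2 := Real.sq_sqrt hs2.le
  have hm : 0 < 1 - (1 - b ^ 2 / a ^ 2) * t ^ 2 := by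
    have : (1 - b ^ 2 / a ^ 2) * t ^ 2 < 1 := by
      have h1 : 1 - b ^ 2 / a ^ 2 < 1 := by
        have : 0 < b ^ 2 / a ^ 2 := by positivity
        linarith
      calc (1 - b ^ 2 / a ^ 2) * t ^ 2 ≤ max (1 - b ^ 2 / a ^ 2) 0 * t ^ 2 := by
            apply mul_le_mul_of_nonneg_right (le_max_left _ _) (sq_nonneg t)
        _ < 1 := by
            have hmax : max (1 - b ^ 2 / a ^ 2) 0 < 1 := max_lt h1 one_pos
            have hmax0 : 0 ≤ max (1 - b ^ 2 / a ^ 2) 0 := le_max_right _ _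
            have ht2 : t ^ 2 < 1 := by nlinarith
            calc max (1 - b ^ 2 / a ^ 2) 0 * t ^ 2 ≤ max (1 - b ^ 2 / a ^ 2) 0 * 1 :=
                  mul_le_mul_of_nonneg_left ht2.le hmax0
              _ < 1 := by linarith
    linarith
  set w := Real.sqrt (1 - (1 - b ^ 2 / a ^ 2) * t ^ 2) with hw
  have hw0 : 0 < w := Real.sqrt_pos.mpr hm
  have hww : w ^ 2 = 1 - (1 - b ^ 2 / a ^ 2) * t ^ 2 := Real.sq_sqrt hm.le
  -- the radicand at `x = bt/s` is the square of `a b w / s²`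
  have hne : 1 - t ^ 2 ≠ 0 := hs2.ne'
  have hane : a ≠ 0 := ha.ne'
  have hrad : ((b * t / s) ^ 2 + a ^ 2) * ((b * t / s) ^ 2 + b ^ 2) = (a * b * w / s ^ 2) ^ 2 := by
    have e1 : (b * t / s) ^ 2 = b ^ 2 * t ^ 2 / (1 - t ^ 2) := by rw [div_pow, mul_pow, hss]
    have e2 : (a * b * w / s ^ 2) ^ 2 = a ^ 2 * b ^ 2 * (1 - (1 - b ^ 2 / a ^ 2) * t ^ 2) / (1 - t ^ 2) ^ 2 := by
      rw [div_pow, mul_pow, mul_pow, hww, ← hss]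
    rw [e1, e2]
    field_simp
    ring
  have hq : 0 < a * b * w / s ^ 2 := by positivity
  rw [hrad, Real.sqrt_sq hq.le, Real.sqrt_mul hs2.le, ← hs, ← hw]
  field_simp

/-- **`I(a,b) = K(1 − b²/a²)/a`**: for `a, b > 0`,
`∫_{(0,∞)} dx/√((x²+a²)(x²+b²)) = (1/a)·ellipticK (1 − b²/a²)` (substitution `x = bt/√(1−t²)`,
`0 < t < 1`). [folklore] -/
theorem integral_Ioi_agm_eq_ellipticK {a b : ℝ} (ha : 0 < a) (hb : 0 < b) :
    ∫ x in Ioi (0 : ℝ), 1 / Real.sqrt ((x ^ 2 + a ^ 2) * (x ^ 2 + b ^ 2)) =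
      1 / a * ellipticK (1 - b ^ 2 / a ^ 2) := by
  set φ : ℝ → ℝ := fun t => b * t / Real.sqrt (1 - t ^ 2) with hφ
  have himage : φ '' Ioo (0 : ℝ) 1 = Ioi 0 := by
    ext x
    constructor
    · rintro ⟨t, ht, rfl⟩
      have hs0 : 0 < Real.sqrt (1 - t ^ 2) := Real.sqrt_pos.mpr (by nlinarith [ht.1, ht.2])
      exact div_pos (mul_pos hb ht.1) hs0
    · intro hx
      have hx0 : 0 < x := hx
      have hr2 : 0 < x ^ 2 + b ^ 2 := by positivity
      set r := Real.sqrt (x ^ 2 + b ^ 2) with hr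
      have hr0 : 0 < r := Real.sqrt_pos.mpr hr2
      have hrr : r ^ 2 = x ^ 2 + b ^ 2 := Real.sq_sqrt hr2.le
      have hxr : x < r := by nlinarith
      refine ⟨x / r, ⟨div_pos hx0 hr0, (div_lt_one hr0).mpr hxr⟩, ?_⟩
      have h1 : 1 - (x / r) ^ 2 = (b / r) ^ 2 := by
        field_simp
        nlinarith [hrr]
      simp only [hφ]
      rw [h1, Real.sqrt_sq (div_pos hb hr0).le]
      field_simp
  have hderiv : ∀ t ∈ Ioo (0 : ℝ) 1,
      HasDerivWithinAt φ (b / (Real.sqrt (1 - t ^ 2)) ^ 3) (Ioo 0 1) t := by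
    intro t ht
    have hs2 : 0 < 1 - t ^ 2 := by nlinarith [ht.1, ht.2]
    have hs0 : 0 < Real.sqrt (1 - t ^ 2) := Real.sqrt_pos.mpr hs2
    have hss : Real.sqrt (1 - t ^ 2) ^ 2 = 1 - t ^ 2 := Real.sq_sqrt hs2.le
    have h1 : HasDerivAt (fun t : ℝ => 1 - t ^ 2) (-(2 * t)) t := by
      simpa using (hasDerivAt_pow 2 t).const_sub 1
    have h2 : HasDerivAt (fun t : ℝ => Real.sqrt (1 - t ^ 2))
        (-(2 * t) / (2 * Real.sqrt (1 - t ^ 2))) t := h1.sqrt hs2.ne'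
    have h3 : HasDerivAt (fun t : ℝ => b * t) b t := by
      simpa using (hasDerivAt_id t).const_mul b
    have h4 := h3.div h2 hs0.ne'
    refine (h4.congr_deriv ?_).hasDerivWithinAt
    field_simp
    nlinarith [hss]
  have hinj : InjOn φ (Ioo 0 1) := by
    intro t₁ h₁ t₂ h₂ heq
    have hs₁ : 0 < 1 - t₁ ^ 2 := by nlinarith [h₁.1, h₁.2]
    have hs₂ : 0 < 1 - t₂ ^ 2 := by nlinarith [h₂.1, h₂.2]
    have hq₁ : 0 < Real.sqrt (1 - t₁ ^ 2) := Real.sqrt_pos.mpr hs₁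
    have hq₂ : 0 < Real.sqrt (1 - t₂ ^ 2) := Real.sqrt_pos.mpr hs₂
    simp only [hφ] at heq
    have h' : t₁ * Real.sqrt (1 - t₂ ^ 2) = t₂ * Real.sqrt (1 - t₁ ^ 2) := by
      field_simp at heq
      linarith
    have h'' : t₁ ^ 2 * (1 - t₂ ^ 2) = t₂ ^ 2 * (1 - t₁ ^ 2) := by
      have := congrArg (fun z => z ^ 2) h'
      simp only [mul_pow, Real.sq_sqrt hs₁.le, Real.sq_sqrt hs₂.le] at this
      exact this
    have h3 : t₁ ^ 2 = t₂ ^ 2 := by nlinarith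
    exact (pow_left_inj₀ h₁.1.le h₂.1.le two_ne_zero).mp h3
  have key := integral_image_eq_integral_abs_deriv_smul measurableSet_Ioo hderiv hinj
    (fun x : ℝ => 1 / Real.sqrt ((x ^ 2 + a ^ 2) * (x ^ 2 + b ^ 2)))
  rw [himage] at key
  rw [key, ellipticK_eq, intervalIntegral.integral_of_le zero_le_one, integral_Ioc_eq_integral_Ioo,
    ← integral_const_mul]
  refine setIntegral_congr_fun measurableSet_Ioo (fun t ht => ?_)
  have hs0 : 0 < Real.sqrt (1 - t ^ 2) := Real.sqrt_pos.mpr (by nlinarith [ht.1, ht.2])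
  simp only [smul_eq_mul, hφ, ellIntegrand]
  rw [abs_of_pos (by positivity)]
  exact agm_subst_tan ha hb ht

/-- Pointwise identity behind Gauss's substitution `x = (t − ab/t)/2`: for `a, b, t > 0`,
`((1 + ab/t²)/2) / √((x² + ((a+b)/2)²)(x² + ab)) = 2/√((t²+a²)(t²+b²))`. [folklore] -/
theorem agm_subst_gauss {a b t : ℝ} (ha : 0 < a) (hb : 0 < b) (ht : 0 < t) :
    (1 + a * b / t ^ 2) / 2 *
        (1 / Real.sqrt ((((t - a * b / t) / 2) ^ 2 + ((a + b) / 2) ^ 2) *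
          (((t - a * b / t) / 2) ^ 2 + a * b))) =
      2 * (1 / Real.sqrt ((t ^ 2 + a ^ 2) * (t ^ 2 + b ^ 2))) := by
  have hP : 0 < (t ^ 2 + a ^ 2) * (t ^ 2 + b ^ 2) := by positivity
  set q := Real.sqrt ((t ^ 2 + a ^ 2) * (t ^ 2 + b ^ 2)) with hq
  have hq0 : 0 < q := Real.sqrt_pos.mpr hP
  have hqq : q ^ 2 = (t ^ 2 + a ^ 2) * (t ^ 2 + b ^ 2) := Real.sq_sqrt hP.le
  have hrad : (((t - a * b / t) / 2) ^ 2 + ((a + b) / 2) ^ 2) * (((t - a * b / t) / 2) ^ 2 + a * b) =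
      ((t ^ 2 + a * b) / (4 * t ^ 2) * q) ^ 2 := by
    rw [mul_pow, hqq]
    field_simp
    ring
  have hpos : 0 < (t ^ 2 + a * b) / (4 * t ^ 2) * q := by positivity
  rw [hrad, Real.sqrt_sq hpos.le]
  field_simp
  ring

/-- **Gauss's AGM invariance**: for `a, b > 0`,
`∫_{(0,∞)} dx/√((x²+((a+b)/2)²)(x²+ab)) = ∫_{(0,∞)} dx/√((x²+a²)(x²+b²))`, by the substitution
`x = (t − ab/t)/2` of `(0,∞)` onto `ℝ` and evenness. [folklore] -/
theorem integral_Ioi_agm_step {a b : ℝ} (ha : 0 < a) (hb : 0 < b) :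
    ∫ x in Ioi (0 : ℝ), 1 / Real.sqrt ((x ^ 2 + ((a + b) / 2) ^ 2) * (x ^ 2 + a * b)) =
      ∫ x in Ioi (0 : ℝ), 1 / Real.sqrt ((x ^ 2 + a ^ 2) * (x ^ 2 + b ^ 2)) := by
  set g : ℝ → ℝ := fun x => 1 / Real.sqrt ((x ^ 2 + ((a + b) / 2) ^ 2) * (x ^ 2 + a * b)) with hg
  -- evenness: `∫_ℝ g = 2 ∫_{(0,∞)} g`
  have heven : ∫ x, g x = 2 * ∫ x in Ioi (0 : ℝ), g x := by
    rw [← integral_comp_abs]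
    congr 1
    funext x
    simp only [hg, sq_abs]
  -- Gauss's substitution
  set ψ : ℝ → ℝ := fun t => (t - a * b / t) / 2 with hψ
  have himage : ψ '' Ioi (0 : ℝ) = univ := by
    ext x
    simp only [mem_image, mem_Ioi, mem_univ, iff_true]
    have hr2 : 0 < x ^ 2 + a * b := by positivity
    set r := Real.sqrt (x ^ 2 + a * b) with hr
    have hr0 : 0 < r := Real.sqrt_pos.mpr hr2
    have hrr : r ^ 2 = x ^ 2 + a * b := Real.sq_sqrt hr2.le
    have hxr : |x| < r := abs_lt_of_sq_lt_sq (by nlinarith [mul_pos ha hb]) hr0.le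
    have ht0 : 0 < x + r := by
      have := (abs_lt.mp hxr).1
      linarith
    refine ⟨x + r, ht0, ?_⟩
    simp only [hψ]
    have : a * b = (r - x) * (r + x) := by nlinarith [hrr]
    rw [this]
    field_simp
    ring
  have hderiv : ∀ t ∈ Ioi (0 : ℝ), HasDerivWithinAt ψ ((1 + a * b / t ^ 2) / 2) (Ioi 0) t := by
    intro t ht
    have ht0 : (t : ℝ) ≠ 0 := (ne_of_gt ht)
    have h1 : HasDerivAt (fun t : ℝ => a * b / t) (-(a * b) / t ^ 2) t := by
      simpa [div_eq_mul_inv] using ((hasDerivAt_inv ht0).const_mul (a * b))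
    have h2 : HasDerivAt (fun t : ℝ => (t - a * b / t) / 2) ((1 - -(a * b) / t ^ 2) / 2) t :=
      ((hasDerivAt_id t).sub h1).div_const 2
    refine (h2.congr_deriv ?_).hasDerivWithinAt
    ring
  have hinj : InjOn ψ (Ioi 0) := by
    intro t₁ h₁ t₂ h₂ heq
    have h₁' : (0 : ℝ) < t₁ := h₁
    have h₂' : (0 : ℝ) < t₂ := h₂
    simp only [hψ] at heq
    have h' : (t₁ - t₂) * (t₁ * t₂ + a * b) = 0 := by
      field_simp at heq
      nlinarith [heq]
    rcases mul_eq_zero.mp h' with h | h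
    · linarith
    · nlinarith [mul_pos h₁' h₂', mul_pos ha hb]
  have key := integral_image_eq_integral_abs_deriv_smul measurableSet_Ioi hderiv hinj g
  rw [himage, Measure.restrict_univ] at key
  have hrhs : ∫ t in Ioi (0 : ℝ), |(1 + a * b / t ^ 2) / 2| • g (ψ t) =
      2 * ∫ t in Ioi (0 : ℝ), 1 / Real.sqrt ((t ^ 2 + a ^ 2) * (t ^ 2 + b ^ 2)) := by
    rw [← integral_const_mul]
    refine setIntegral_congr_fun measurableSet_Ioi (fun t ht => ?_)
    have ht0 : (0 : ℝ) < t := ht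
    simp only [smul_eq_mul, hg, hψ]
    rw [abs_of_pos (by positivity)]
    exact agm_subst_gauss ha hb ht0
  have h2 : (2 : ℝ) * ∫ x in Ioi (0 : ℝ), g x =
      2 * ∫ t in Ioi (0 : ℝ), 1 / Real.sqrt ((t ^ 2 + a ^ 2) * (t ^ 2 + b ^ 2)) := by
    rw [← heven, key, hrhs]
  have := mul_left_cancel₀ (two_ne_zero) h2
  simpa only [hg] using this

/-- **Landen's transformation** (descending form): for `0 < k < 1`, with `k′ = √(1−k²)`,
`K(k) = (2/(1+k′))·K((1−k′)/(1+k′))`. Proof: `K(k) = I(1,k′) = I((1+k′)/2, √k′)` (Gauss) and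
`I((1+k′)/2, √k′) = (2/(1+k′))K((1−k′)/(1+k′))` since `1 − 4k′/(1+k′)² = ((1−k′)/(1+k′))²`.
[cite: Zhou2013, §5.1 proof of Prop. 5.1 ("Landen's transformation")] -/
theorem completeEllipticK_landen {k : ℝ} (hk : k ∈ Ioo (0 : ℝ) 1) :
    completeEllipticK k =
      2 / (1 + Real.sqrt (1 - k ^ 2)) *
        completeEllipticK ((1 - Real.sqrt (1 - k ^ 2)) / (1 + Real.sqrt (1 - k ^ 2))) := by
  have hk2 : 0 < 1 - k ^ 2 := by nlinarith [hk.1, hk.2]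
  set k' := Real.sqrt (1 - k ^ 2) with hk'
  have hk'0 : 0 < k' := Real.sqrt_pos.mpr hk2
  have hk'k' : k' ^ 2 = 1 - k ^ 2 := Real.sq_sqrt hk2.le
  have hk'1 : k' < 1 := by nlinarith [hk.1]
  -- `K(k) = I(1, k′)`
  have h1 : completeEllipticK k = ∫ x in Ioi (0 : ℝ), 1 / Real.sqrt ((x ^ 2 + 1 ^ 2) * (x ^ 2 + k' ^ 2)) := by
    rw [integral_Ioi_agm_eq_ellipticK one_pos hk'0, completeEllipticK_eq_ellipticK]
    simp [hk'k']
  -- `I((1+k′)/2, √k′) = (2/(1+k′)) K((1−k′)/(1+k′))`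
  set A := (1 + k') / 2 with hA
  have hA0 : 0 < A := by positivity
  have hB0 : 0 < Real.sqrt k' := Real.sqrt_pos.mpr hk'0
  have h2 : ∫ x in Ioi (0 : ℝ), 1 / Real.sqrt ((x ^ 2 + A ^ 2) * (x ^ 2 + Real.sqrt k' ^ 2)) =
      2 / (1 + k') * completeEllipticK ((1 - k') / (1 + k')) := by
    rw [integral_Ioi_agm_eq_ellipticK hA0 hB0, completeEllipticK_eq_ellipticK, Real.sq_sqrt hk'0.le]
    have hpar : 1 - k' / A ^ 2 = ((1 - k') / (1 + k')) ^ 2 := by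
      rw [hA]; field_simp; ring
    rw [hpar, hA]
    congr 1
    field_simp
  rw [h1, ← h2, Real.sq_sqrt hk'0.le]
  have h3 := integral_Ioi_agm_step (a := 1) (b := k') one_pos hk'0
  rw [one_mul] at h3
  rw [← h3, hA]

/-- Landen, ascending form on `(0,1)`: `K(2√ξ/(1+ξ)) = (1+ξ)·K(ξ)`.
[cite: Zhou2013, §5.1 proof of Prop. 5.1 ("Landen's transformation K(2√ξ/(1+ξ)) = (1+ξ)K(ξ)")] -/
theorem completeEllipticK_landen_asc {ξ : ℝ} (hξ : ξ ∈ Ioo (0 : ℝ) 1) :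
    completeEllipticK (2 * Real.sqrt ξ / (1 + ξ)) = (1 + ξ) * completeEllipticK ξ := by
  have hξ0 := hξ.1
  have hξ1 := hξ.2
  have hs : Real.sqrt ξ ^ 2 = ξ := Real.sq_sqrt hξ0.le
  have hs0 : 0 < Real.sqrt ξ := Real.sqrt_pos.mpr hξ0
  have hs1 : Real.sqrt ξ < 1 := by nlinarith
  set k := 2 * Real.sqrt ξ / (1 + ξ) with hk
  have hk0 : 0 < k := by positivity
  have hk1 : k < 1 := by
    rw [hk, div_lt_one (by linarith)]
    nlinarith [sq_nonneg (1 - Real.sqrt ξ)]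
  have hcomp : Real.sqrt (1 - k ^ 2) = (1 - ξ) / (1 + ξ) := by
    have : 1 - k ^ 2 = ((1 - ξ) / (1 + ξ)) ^ 2 := by
      rw [hk, div_pow, mul_pow, hs]; field_simp; ring
    rw [this, Real.sqrt_sq (div_nonneg (by linarith) (by linarith))]
  have hL := completeEllipticK_landen ⟨hk0, hk1⟩
  rw [hcomp] at hL
  have e1 : 2 / (1 + (1 - ξ) / (1 + ξ)) = 1 + ξ := by field_simp; ring
  have e2 : (1 - (1 - ξ) / (1 + ξ)) / (1 + (1 - ξ) / (1 + ξ)) = ξ := by field_simp; ring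
  rw [e1, e2] at hL
  exact hL

/-- Landen, descending form on `(0,1)`: `K((1−ξ)/(1+ξ)) = ((1+ξ)/2)·K(√(1−ξ²))`.
[cite: Zhou2013, §5.1 proof of Prop. 5.1 ("Landen's transformation 2K((1−ξ)/(1+ξ)) = (1+ξ)K(√(1−ξ²))")] -/
theorem completeEllipticK_landen_desc {ξ : ℝ} (hξ : ξ ∈ Ioo (0 : ℝ) 1) :
    completeEllipticK ((1 - ξ) / (1 + ξ)) = (1 + ξ) / 2 * completeEllipticK (Real.sqrt (1 - ξ ^ 2)) := by
  have hξ0 := hξ.1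
  have hξ1 := hξ.2
  have h1 : 0 < 1 - ξ ^ 2 := by nlinarith
  set k := Real.sqrt (1 - ξ ^ 2) with hk
  have hk0 : 0 < k := Real.sqrt_pos.mpr h1
  have hkk : k ^ 2 = 1 - ξ ^ 2 := Real.sq_sqrt h1.le
  have hk1 : k < 1 := by nlinarith
  have hcomp : Real.sqrt (1 - k ^ 2) = ξ := by
    rw [hkk, sub_sub_cancel, Real.sqrt_sq hξ0.le]
  have hL := completeEllipticK_landen ⟨hk0, hk1⟩
  rw [hcomp] at hL
  rw [hL]
  field_simp

/-! ### The second line of Prop. 5.1: `3∫K²K′ = 2∫KK′² = 6∫K²K′k` by Landen -/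

/-- Change of variables `k = (1−ξ)/(1+ξ)` (a decreasing involution of `(0,1)`;
`|dk/dξ| = 2/(1+ξ)²`): `∫_{(0,1)} g(k) dk = ∫_{(0,1)} (2/(1+ξ)²) g((1−ξ)/(1+ξ)) dξ`, for every `g`.
[cite: Zhou2013, §5.1 proof of Prop. 5.1 ("Writing k = (1−ξ)/(1+ξ)")] -/
theorem integral_Ioo_comp_moebius (g : ℝ → ℝ) :
    ∫ x in Ioo (0 : ℝ) 1, g x =
      ∫ ξ in Ioo (0 : ℝ) 1, 2 / (1 + ξ) ^ 2 * g ((1 - ξ) / (1 + ξ)) := by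
  set φ : ℝ → ℝ := fun ξ => (1 - ξ) / (1 + ξ) with hφ
  have hmem : ∀ ξ ∈ Ioo (0 : ℝ) 1, φ ξ ∈ Ioo (0 : ℝ) 1 := fun ξ hξ =>
    ⟨div_pos (by linarith [hξ.2]) (by linarith [hξ.1]),
      (div_lt_one (by linarith [hξ.1])).mpr (by linarith [hξ.1])⟩
  have hinv : ∀ ξ ∈ Ioo (0 : ℝ) 1, φ (φ ξ) = ξ := fun ξ hξ => by
    have : (1 + ξ) ≠ 0 := by linarith [hξ.1]
    simp only [hφ]
    field_simp
    ring
  have himage : φ '' Ioo (0 : ℝ) 1 = Ioo 0 1 := by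
    ext x
    constructor
    · rintro ⟨ξ, hξ, rfl⟩
      exact hmem ξ hξ
    · intro hx
      exact ⟨φ x, hmem x hx, hinv x hx⟩
  have hderiv : ∀ ξ ∈ Ioo (0 : ℝ) 1, HasDerivWithinAt φ (-2 / (1 + ξ) ^ 2) (Ioo 0 1) ξ := by
    intro ξ hξ
    have hne : (1 + ξ) ≠ 0 := by linarith [hξ.1]
    have h1 : HasDerivAt (fun ξ : ℝ => 1 - ξ) (-1) ξ := by
      simpa using (hasDerivAt_id ξ).const_sub 1
    have h2 : HasDerivAt (fun ξ : ℝ => 1 + ξ) 1 ξ := by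
      simpa using (hasDerivAt_id ξ).const_add 1
    have h3 := h1.div h2 hne
    refine (h3.congr_deriv ?_).hasDerivWithinAt
    field_simp
    ring
  have hinj : InjOn φ (Ioo 0 1) := by
    intro ξ₁ h₁ ξ₂ h₂ heq
    rw [← hinv ξ₁ h₁, ← hinv ξ₂ h₂]
    exact congrArg φ heq
  have key := integral_image_eq_integral_abs_deriv_smul measurableSet_Ioo hderiv hinj g
  rw [himage] at key
  rw [key]
  refine setIntegral_congr_fun measurableSet_Ioo (fun ξ hξ => ?_)
  have hpos : 0 < 2 / (1 + ξ) ^ 2 := by have := hξ.1; positivity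
  simp only [smul_eq_mul, hφ]
  rw [show -2 / (1 + ξ) ^ 2 = -(2 / (1 + ξ) ^ 2) by ring, abs_neg, abs_of_pos hpos]

/-- The complementary modulus of `(1−ξ)/(1+ξ)` is `2√ξ/(1+ξ)` (`0 < ξ < 1`). [folklore] -/
theorem sqrt_one_sub_moebius_sq {ξ : ℝ} (hξ : ξ ∈ Ioo (0 : ℝ) 1) :
    Real.sqrt (1 - ((1 - ξ) / (1 + ξ)) ^ 2) = 2 * Real.sqrt ξ / (1 + ξ) := by
  have hne : (1 + ξ) ≠ 0 := by linarith [hξ.1]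
  have hs : Real.sqrt ξ ^ 2 = ξ := Real.sq_sqrt hξ.1.le
  have h : 1 - ((1 - ξ) / (1 + ξ)) ^ 2 = (2 * Real.sqrt ξ / (1 + ξ)) ^ 2 := by
    rw [div_pow, div_pow, mul_pow, hs]
    field_simp
    ring
  rw [h, Real.sqrt_sq (by have := hξ.1; positivity)]

/-- `K(k)·K(√(1−k²))²·k` is integrable on `(0,1)`. [cite: Zhou2013, Prop. 5.1] -/
theorem integrableOn_completeEllipticK_mul_compl_sq_mul_id :
    IntegrableOn (fun k : ℝ => completeEllipticK k * completeEllipticK (Real.sqrt (1 - k ^ 2)) ^ 2 * k)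
      (Ioo 0 1) :=
  integrableOn_completeEllipticK_mul_compl_sq.mul_continuousOn_of_subset continuousOn_id
    measurableSet_Ioo isCompact_Icc Ioo_subset_Icc_self

/-- `∫₀¹ K K′² k dk = ∫₀¹ K² K′ k dk` (the substitution `k ↦ √(1−k²)`).
[cite: Zhou2013, §5.1 proof of Prop. 5.1 ("a trivial substitution ξ ↦ √(1−η²)")] -/
theorem integral_K_mul_compl_sq_mul_id :
    ∫ k in Ioo (0 : ℝ) 1, completeEllipticK k * completeEllipticK (Real.sqrt (1 - k ^ 2)) ^ 2 * k =
      ∫ k in Ioo (0 : ℝ) 1, completeEllipticK k ^ 2 * completeEllipticK (Real.sqrt (1 - k ^ 2)) * k := by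
  rw [integral_Ioo_comp_sqrt_one_sub_sq
    (fun k => completeEllipticK k * completeEllipticK (Real.sqrt (1 - k ^ 2)) ^ 2 * k)]
  refine setIntegral_congr_fun measurableSet_Ioo (fun t ht => ?_)
  have h1 : 0 < 1 - t ^ 2 := by nlinarith [ht.1, ht.2]
  have hs0 : 0 < Real.sqrt (1 - t ^ 2) := Real.sqrt_pos.mpr h1
  rw [Real.sq_sqrt h1.le, sub_sub_cancel, Real.sqrt_sq ht.1.le]
  field_simp

/-- **`∫₀¹ K²K′ dk = ½∫₀¹ KK′² dk + ½∫₀¹ KK′²k dk`** by `k = (1−ξ)/(1+ξ)` and Landen twice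
(`K((1−ξ)/(1+ξ)) = ((1+ξ)/2)K′(ξ)`, `K′((1−ξ)/(1+ξ)) = K(2√ξ/(1+ξ)) = (1+ξ)K(ξ)`).
[cite: Zhou2013, §5.1 proof of Prop. 5.1] -/
theorem integral_K_sq_mul_compl_eq_half_add_half :
    ∫ k in Ioo (0 : ℝ) 1, completeEllipticK k ^ 2 * completeEllipticK (Real.sqrt (1 - k ^ 2)) =
      (1 / 2 * ∫ k in Ioo (0 : ℝ) 1, completeEllipticK k * completeEllipticK (Real.sqrt (1 - k ^ 2)) ^ 2) +
      1 / 2 * ∫ k in Ioo (0 : ℝ) 1,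
        completeEllipticK k * completeEllipticK (Real.sqrt (1 - k ^ 2)) ^ 2 * k := by
  rw [integral_Ioo_comp_moebius, ← integral_const_mul, ← integral_const_mul,
    ← integral_add (integrableOn_completeEllipticK_mul_compl_sq.const_mul _)
      (integrableOn_completeEllipticK_mul_compl_sq_mul_id.const_mul _)]
  refine setIntegral_congr_fun measurableSet_Ioo (fun ξ hξ => ?_)
  have hne : (1 + ξ) ≠ 0 := by linarith [hξ.1]
  rw [sqrt_one_sub_moebius_sq hξ, completeEllipticK_landen_desc hξ, completeEllipticK_landen_asc hξ]
  field_simp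

/-- **`∫₀¹ KK′² dk = ∫₀¹ K²K′ dk + ∫₀¹ K²K′k dk`** by the same substitution and Landen.
[cite: Zhou2013, §5.1 proof of Prop. 5.1] -/
theorem integral_K_mul_compl_sq_eq_add :
    ∫ k in Ioo (0 : ℝ) 1, completeEllipticK k * completeEllipticK (Real.sqrt (1 - k ^ 2)) ^ 2 =
      (∫ k in Ioo (0 : ℝ) 1, completeEllipticK k ^ 2 * completeEllipticK (Real.sqrt (1 - k ^ 2))) +
      ∫ k in Ioo (0 : ℝ) 1, completeEllipticK k ^ 2 * completeEllipticK (Real.sqrt (1 - k ^ 2)) * k := by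
  rw [integral_Ioo_comp_moebius (fun k => completeEllipticK k * completeEllipticK (Real.sqrt (1 - k ^ 2)) ^ 2),
    ← integral_add integrableOn_completeEllipticK_sq_mul_compl
      integrableOn_completeEllipticK_sq_mul_compl_mul_id]
  refine setIntegral_congr_fun measurableSet_Ioo (fun ξ hξ => ?_)
  have hne : (1 + ξ) ≠ 0 := by linarith [hξ.1]
  rw [sqrt_one_sub_moebius_sq hξ, completeEllipticK_landen_desc hξ, completeEllipticK_landen_asc hξ]
  field_simp

/-- **Zhou 2013, Prop. 5.1, second line, `3∫₀¹K²K′ dk = 6∫₀¹K²K′k dk`**: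
`∫₀¹ K(k)²K(√(1−k²)) dk = 2∫₀¹ K(k)²K(√(1−k²)) k dk` ("established by successive Landen's
transformations, as detailed in the first paragraph of [Wan2012]"). [cite: Zhou2013, Prop. 5.1] -/
theorem integral_K_sq_mul_compl_eq_two_mul :
    ∫ k in Ioo (0 : ℝ) 1, completeEllipticK k ^ 2 * completeEllipticK (Real.sqrt (1 - k ^ 2)) =
      2 * ∫ k in Ioo (0 : ℝ) 1, completeEllipticK k ^ 2 * completeEllipticK (Real.sqrt (1 - k ^ 2)) * k := by
  have h1 := integral_K_sq_mul_compl_eq_half_add_half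
  have h2 := integral_K_mul_compl_sq_eq_add
  have h3 := integral_K_mul_compl_sq_mul_id
  rw [h3, h2] at h1
  linarith

/-- **Zhou 2013, Prop. 5.1, second line, `2∫₀¹KK′² dk = 6∫₀¹K²K′k dk`**:
`∫₀¹ K(k)K(√(1−k²))² dk = 3∫₀¹ K(k)²K(√(1−k²)) k dk`. [cite: Zhou2013, Prop. 5.1] -/
theorem integral_K_mul_compl_sq_eq_three_mul :
    ∫ k in Ioo (0 : ℝ) 1, completeEllipticK k * completeEllipticK (Real.sqrt (1 - k ^ 2)) ^ 2 =
      3 * ∫ k in Ioo (0 : ℝ) 1, completeEllipticK k ^ 2 * completeEllipticK (Real.sqrt (1 - k ^ 2)) * k := by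
  rw [integral_K_mul_compl_sq_eq_add, integral_K_sq_mul_compl_eq_two_mul]
  ring

/-! ### The first line of Prop. 5.1: `∫K′³ = (10/3)∫K³ = 5∫K³k` by Landen -/

/-- `K(k)³` is integrable on `(0,1)` (`≤ 512·(1−k²)^{−3/8}`). [cite: Zhou2013, Prop. 5.1] -/
theorem integrableOn_completeEllipticK_pow_three :
    IntegrableOn (fun k : ℝ => completeEllipticK k ^ 3) (Ioo 0 1) := by
  refine integrableOn_Ioo_of_le_rpow_neg_mul (C := 512) (a := 0) (b := 3 / 8) (by norm_num)
    le_rfl (by norm_num) (by norm_num) (by norm_num)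
    (aestronglyMeasurable_completeEllipticK_Ioo.pow 3) fun k hk => ?_
  have h0 : 0 ≤ completeEllipticK k := completeEllipticK_nonneg _
  have h1 := completeEllipticK_le hk
  have h1k2 : 0 < 1 - k ^ 2 := by nlinarith [hk.1, hk.2]
  rw [abs_of_nonneg (pow_nonneg h0 3), neg_zero, Real.rpow_zero, mul_one]
  calc completeEllipticK k ^ 3 ≤ (8 * (1 - k ^ 2) ^ (-(1 / 8 : ℝ))) ^ 3 := pow_le_pow_left₀ h0 h1 3
    _ = 512 * (1 - k ^ 2) ^ (-(3 / 8 : ℝ)) := by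
        rw [mul_pow, ← Real.rpow_natCast ((1 - k ^ 2) ^ (-(1 / 8 : ℝ))), ← Real.rpow_mul h1k2.le]
        norm_num

/-- `K(k)³·k` is integrable on `(0,1)`. [cite: Zhou2013, Prop. 5.1] -/
theorem integrableOn_completeEllipticK_pow_three_mul_id :
    IntegrableOn (fun k : ℝ => completeEllipticK k ^ 3 * k) (Ioo 0 1) :=
  integrableOn_completeEllipticK_pow_three.mul_continuousOn_of_subset continuousOn_id
    measurableSet_Ioo isCompact_Icc Ioo_subset_Icc_self

/-- `K(√(1−k²))³·k` is integrable on `(0,1)`. [cite: Zhou2013, Prop. 5.1] -/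
theorem integrableOn_completeEllipticK_compl_pow_three_mul_id :
    IntegrableOn (fun k : ℝ => completeEllipticK (Real.sqrt (1 - k ^ 2)) ^ 3 * k) (Ioo 0 1) :=
  integrableOn_completeEllipticK_compl_pow_three.mul_continuousOn_of_subset continuousOn_id
    measurableSet_Ioo isCompact_Icc Ioo_subset_Icc_self

/-- `∫₀¹ K′³ k dk = ∫₀¹ K³ k dk` (the substitution `k ↦ √(1−k²)`).
[cite: Zhou2013, §5.1 proof of Prop. 5.1 ("a trivial substitution ξ ↦ √(1−η²)")] -/
theorem integral_Kcompl_pow_three_mul_id :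
    ∫ k in Ioo (0 : ℝ) 1, completeEllipticK (Real.sqrt (1 - k ^ 2)) ^ 3 * k =
      ∫ k in Ioo (0 : ℝ) 1, completeEllipticK k ^ 3 * k := by
  rw [integral_Ioo_comp_sqrt_one_sub_sq (fun k => completeEllipticK (Real.sqrt (1 - k ^ 2)) ^ 3 * k)]
  refine setIntegral_congr_fun measurableSet_Ioo (fun t ht => ?_)
  have h1 : 0 < 1 - t ^ 2 := by nlinarith [ht.1, ht.2]
  have hs0 : 0 < Real.sqrt (1 - t ^ 2) := Real.sqrt_pos.mpr h1
  rw [Real.sq_sqrt h1.le, sub_sub_cancel, Real.sqrt_sq ht.1.le]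
  field_simp

/-- **`∫₀¹ K′³ dk = 2∫₀¹ K³ dk + 2∫₀¹ K³k dk`** by `k = (1−ξ)/(1+ξ)` and Landen
(`K′((1−ξ)/(1+ξ)) = (1+ξ)K(ξ)`). [cite: Zhou2013, §5.1 proof of Prop. 5.1] -/
theorem integral_Kcompl_pow_three_eq_two_add_two :
    ∫ k in Ioo (0 : ℝ) 1, completeEllipticK (Real.sqrt (1 - k ^ 2)) ^ 3 =
      (2 * ∫ k in Ioo (0 : ℝ) 1, completeEllipticK k ^ 3) +
      2 * ∫ k in Ioo (0 : ℝ) 1, completeEllipticK k ^ 3 * k := by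
  rw [integral_Ioo_comp_moebius (fun k => completeEllipticK (Real.sqrt (1 - k ^ 2)) ^ 3),
    ← integral_const_mul, ← integral_const_mul,
    ← integral_add (integrableOn_completeEllipticK_pow_three.const_mul _)
      (integrableOn_completeEllipticK_pow_three_mul_id.const_mul _)]
  refine setIntegral_congr_fun measurableSet_Ioo (fun ξ hξ => ?_)
  have hne : (1 + ξ) ≠ 0 := by linarith [hξ.1]
  rw [sqrt_one_sub_moebius_sq hξ, completeEllipticK_landen_asc hξ]
  field_simp

/-- **`∫₀¹ K³ dk = ¼∫₀¹ K′³ dk + ¼∫₀¹ K′³k dk`** by `k = (1−ξ)/(1+ξ)` and Landen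
(`K((1−ξ)/(1+ξ)) = ((1+ξ)/2)K′(ξ)`). [cite: Zhou2013, §5.1 proof of Prop. 5.1] -/
theorem integral_K_pow_three_eq_quarter_add_quarter :
    ∫ k in Ioo (0 : ℝ) 1, completeEllipticK k ^ 3 =
      (1 / 4 * ∫ k in Ioo (0 : ℝ) 1, completeEllipticK (Real.sqrt (1 - k ^ 2)) ^ 3) +
      1 / 4 * ∫ k in Ioo (0 : ℝ) 1, completeEllipticK (Real.sqrt (1 - k ^ 2)) ^ 3 * k := by
  rw [integral_Ioo_comp_moebius (fun k => completeEllipticK k ^ 3),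
    ← integral_const_mul, ← integral_const_mul,
    ← integral_add (integrableOn_completeEllipticK_compl_pow_three.const_mul _)
      (integrableOn_completeEllipticK_compl_pow_three_mul_id.const_mul _)]
  refine setIntegral_congr_fun measurableSet_Ioo (fun ξ hξ => ?_)
  have hne : (1 + ξ) ≠ 0 := by linarith [hξ.1]
  rw [completeEllipticK_landen_desc hξ]
  field_simp
  ring

/-- **Zhou 2013, Prop. 5.1, first line: `∫₀¹K′³ dk = (10/3)∫₀¹K³ dk`.** [cite: Zhou2013, Prop. 5.1] -/
theorem integral_Kcompl_pow_three_eq_ten_thirds_mul :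
    ∫ k in Ioo (0 : ℝ) 1, completeEllipticK (Real.sqrt (1 - k ^ 2)) ^ 3 =
      10 / 3 * ∫ k in Ioo (0 : ℝ) 1, completeEllipticK k ^ 3 := by
  have h1 := integral_Kcompl_pow_three_eq_two_add_two
  have h2 := integral_K_pow_three_eq_quarter_add_quarter
  rw [integral_Kcompl_pow_three_mul_id] at h2
  linarith

/-- **Zhou 2013, Prop. 5.1, first line: `∫₀¹K′³ dk = 5∫₀¹K³k dk`.** [cite: Zhou2013, Prop. 5.1] -/
theorem integral_Kcompl_pow_three_eq_five_mul :
    ∫ k in Ioo (0 : ℝ) 1, completeEllipticK (Real.sqrt (1 - k ^ 2)) ^ 3 =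
      5 * ∫ k in Ioo (0 : ℝ) 1, completeEllipticK k ^ 3 * k := by
  have h1 := integral_Kcompl_pow_three_eq_two_add_two
  have h2 := integral_K_pow_three_eq_quarter_add_quarter
  rw [integral_Kcompl_pow_three_mul_id] at h2
  linarith

/-- **Zhou 2013, Prop. 5.1, first line, last member with `K′`: `∫₀¹K′³ dk = 5∫₀¹K′³k dk`.**
[cite: Zhou2013, Prop. 5.1] -/
theorem integral_Kcompl_pow_three_eq_five_mul' :
    ∫ k in Ioo (0 : ℝ) 1, completeEllipticK (Real.sqrt (1 - k ^ 2)) ^ 3 =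
      5 * ∫ k in Ioo (0 : ℝ) 1, completeEllipticK (Real.sqrt (1 - k ^ 2)) ^ 3 * k := by
  rw [integral_Kcompl_pow_three_mul_id]
  exact integral_Kcompl_pow_three_eq_five_mul

end Literature.Analysis.SpecialFunctions

end
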